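import Mathlib
import HarnessLib
import Summits.ResolutionOfSingularities.Statement
import Literature.AlgebraicGeometry.Resolution.AffineBlowup
import Literature.AlgebraicGeometry.Resolution.Blowups
import Literature.AlgebraicGeometry.Resolution.MarkedIdeals
import Literature.AlgebraicGeometry.Resolution.BlowupSequences

/-!
# PunctualFirstTransform — definitions and sliced kernels for the decomp-res node «FirstTransform»

Cell decomp-res (ResolutionOfSingularities, residual mode), lens-4 g5 node FirstTransform = CHILD NODE of the
route `DeepSandwich` on its punctual hub `DeepSandwich.AffinePunctualResolve` (item stmt-28257; APR: blow-ups of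
𝔸ⁿ_k in 𝔪-primary ideals have resolutions).  CRITIC-LEDGER row 36 (2026-08-30T05:34:58Z): CLEARED AS CHILD NODE
WITH ATTACK CONTENT; lens-4 g6 ANSWER 05:44:38Z (bookings accepted).  Source: HOME/decomp-res-lens-4/g5/
FirstTransform.lean sha256 6b39ab25… (426 lines; the critic's own `lean check` rc 0 · 0 sorry · axioms standard).

THIS FILE (writer decomp-res-writer-1 g3, phase 1 of the filing) lands the node's ELEMENTARY TYPING and its
n-SLICED pieces as problem-side definitions, so that the route asides (phase 2: `OrderOnePunctualResolve`,
`OrderTwoPunctualResolve` [declared located residual], `SmoothConePunctualResolve`, `SmoothConePunctualResolveLowDim`,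
`ConeTransfer` on route DeepSandwich) are one-line Props over existing declarations, and the by-name kernels
(phase 3, `Theorems/DeepSandwichFirstTransform.lean`: APR ⟺ O1 ∧ O2, `closes`, necessity, SCR≤4 ⟸ ConeTransfer +
X1@1) can import both.  It does NOT import the route file (no cycle).

NEW ORDER PARAMETER μ₁(I) = the maximal order of the FIRST WEAK TRANSFORM of the punctual ideal `I` (initial degree
ν) on `Bl_0 𝔸ⁿ`, typed without schemes: chart `i` is the substitution `x_i ↦ x_i, x_j ↦ x_i x_j` (`chartMap`), the
weak transform in chart `i` is `weakTransformChart I ν i`, and «μ₁ ≤ 1» is `FirstTransformOrderLeOne I ν` (the weak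
transform lies in no `𝔫²`, 𝔫 maximal).  EXACT BISECTION per slice (kernel `affinePunctualResolveAt_iff`, excluded
middle on the datum): `AffinePunctualResolveAt n ⟺ OrderOnePunctualResolveAt n ∧ OrderTwoPunctualResolveAt n`.
Tags (critic row 36): O1ₙ — WEAKER than APR by letter, O1₄ CLOSED-MOD-{PORT X1@1 (CossartPiltant2019 Prop 4.4 + 4.3 /
CJS; weak form k̄ Cutkosky2009 Thm 5.1), lens-5 ExhaustionBridge@1, plumbing}; O1ₙ (n ≥ 5) UNDECIDED (obstruction =
closure-regularisation + X1@1 one dimension down); O2 — DECLARED LOCATED RESIDUAL, UNDECIDED(costume-risk), score 0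
(located on Cell(4,4,p) at «c vanishes at a vertex point of q»; instrument T-mu1-punct endorsed); SCR — WEAKER-BY-
DIMENSION-DROP certified by THEOREM A = ConeTransfer (NEW LEMMA, paper proof checked by the critic: one GLOBAL
hypersurface of maximal contact given by the datum's smooth cone member, replay with controlled transforms, glue —
prover target #3 of the cell); `MarkedPrincipalization d` — PORT (d ≤ 3 in print at marking 1; open from 4;
`MarkedPrincipalization 3` ≡ lens-5's `MarkedThreefoldResolutionAt 1`, dedup by name in phase 3).
Census data: HOME/census/punct/T-torusfree-punct.md sha256 038fb35d… (first-open punctual sub-cell Cell(4,4,p)).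
WHY THIS IS NOVEL (critic-endorsed): the cell's cuts so far read letters of the datum at the origin or predicates on
models; this cut reads the first step of the blow-up dynamics, is coordinate-free and decidable on the datum, and is
DISJOINT from Theorem H's radially-fixable class on isolated-vertex quadrics.
-/

open AlgebraicGeometry CategoryTheory Literature.AlgebraicGeometry.Resolution

namespace Summit.ResolutionOfSingularities.ResolutionOfSingularities.Theorems.PunctualFirstTransform

/-! ## Elementary typing of the first weak transform (DEFINITIONS, support) -/

/-- `ν` is the INITIAL DEGREE (order at the origin) of `I ⊆ k[x₁,…,xₙ]`: every member has vanishing homogeneous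
components below `ν`, and some member has a nonzero component of degree `ν`.  DEFINITION (support). -/
def IsInitialDegree {k : Type} [Field k] {n : ℕ} (I : Ideal (MvPolynomial (Fin n) k)) (ν : ℕ) : Prop :=
  (∀ f ∈ I, ∀ d < ν, MvPolynomial.homogeneousComponent d f = 0) ∧
    ∃ g ∈ I, MvPolynomial.homogeneousComponent ν g ≠ 0

/-- The `i`-th affine chart of the blow-up of `𝔸ⁿ` at the origin, as the substitution `x_i ↦ x_i`,
`x_j ↦ x_i·x_j (j ≠ i)` on `k[x₁,…,xₙ]`.  DEFINITION (support). -/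
noncomputable def chartMap {k : Type} [Field k] {n : ℕ} (i : Fin n) :
    MvPolynomial (Fin n) k →ₐ[k] MvPolynomial (Fin n) k :=
  MvPolynomial.aeval fun j => if j = i then MvPolynomial.X i else MvPolynomial.X i * MvPolynomial.X j

/-- The WEAK (controlled) transform of `I` in chart `i` for the exponent `ν`: the ideal generated by all `h` with
`chartᵢ(f) = x_i^ν · h` for some `f ∈ I` (when `ν` is the initial degree every `chartᵢ(f)` is so divisible, and the
quotient is unique).  DEFINITION (support). -/
noncomputable def weakTransformChart {k : Type} [Field k] {n : ℕ} (I : Ideal (MvPolynomial (Fin n) k)) (ν : ℕ) (i : Fin n) :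
    Ideal (MvPolynomial (Fin n) k) :=
  Ideal.span {h | ∃ f ∈ I, chartMap i f = MvPolynomial.X i ^ ν * h}

/-- «`μ₁(I) ≤ 1`»: in every chart the weak transform has order ≤ 1 at every closed point, i.e. is not contained in the
square of any maximal ideal of `k[x₁,…,xₙ]`.  DEFINITION (support; decidable on the datum by Gröbner + Jacobian). -/
def FirstTransformOrderLeOne {k : Type} [Field k] {n : ℕ} (I : Ideal (MvPolynomial (Fin n) k)) (ν : ℕ) : Prop :=
  ∀ i : Fin n, ∀ 𝔫 : Ideal (MvPolynomial (Fin n) k), 𝔫.IsMaximal → ¬ (weakTransformChart I ν i ≤ 𝔫 ^ 2)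

/-- `I` has a SMOOTH CONE MEMBER: for the initial degree `ν` there is `g ∈ I` whose degree-`ν` form `G` is nonzero and
whose cone `V(G)` is smooth at every nonzero point (over every field extension `K ⊇ k`) of the tangent cone
`C = V(in_ν I)` — Jacobian typing: at every such point some partial derivative of `G` does not vanish.  (`σ(I) = -1`
in the node's notation.)  DEFINITION (support). -/
def HasSmoothConeMember {k : Type} [Field k] {n : ℕ} (I : Ideal (MvPolynomial (Fin n) k)) : Prop :=
  ∃ ν : ℕ, IsInitialDegree I ν ∧ ∃ g ∈ I, MvPolynomial.homogeneousComponent ν g ≠ 0 ∧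
    ∀ (K : Type) [Field K] [Algebra k K] (v : Fin n → K), v ≠ 0 →
      (∀ f ∈ I, MvPolynomial.aeval v (MvPolynomial.homogeneousComponent ν f) = 0) →
        ∃ i : Fin n, MvPolynomial.aeval v (MvPolynomial.pderiv i (MvPolynomial.homogeneousComponent ν g)) ≠ 0

/-! ## Slices of the target -/

/-- APR sliced by the number of variables `n` (APR ⟺ ∀ n, APRAt n: kernel `affinePunctualResolve_iff_slices`). -/
def AffinePunctualResolveAt (n : ℕ) : Prop :=
  ∀ p : ℕ, p.Prime → ∀ (k : Type) [Field k] [CharP k p] (I : Ideal (MvPolynomial (Fin n) k)), I ≠ ⊥ →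
    (∃ N : ℕ, RingHom.ker (MvPolynomial.constantCoeff : MvPolynomial (Fin n) k →+* k) ^ N ≤ I) →
      Scheme.HasResolution (affineBlowup I)

/-! ## The pieces -/

/-- Piece O1 sliced: **punctual ideals whose first weak transform has order ≤ 1 everywhere have resolvable
blow-ups** (in `n` variables).  NECESSARY (kernel).  `n = 4`: CLOSED-MOD-{PORT X1@1 = `MarkedPrincipalization 3`
(in print at marking 1), lens-5 `ExhaustionBridge`@1, plumbing P} — content = threefold principalization + CJS, hence
STRICTLY WEAKER than APR₄ in substance.  `n ≥ 5`: UNDECIDED (globalisation seam), except on the sub-rung SCR.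
Why it might fail as typed: only through the ports (X1 as typed asks snc-admissibility).
[CossartPiltant2019 4.3/4.4, Cutkosky2009 5.1, CossartJannsenSaito2020, Kollar2007 3.105] -/
def OrderOnePunctualResolveAt (n : ℕ) : Prop :=
  ∀ p : ℕ, p.Prime → ∀ (k : Type) [Field k] [CharP k p] (I : Ideal (MvPolynomial (Fin n) k)), I ≠ ⊥ →
    (∃ N : ℕ, RingHom.ker (MvPolynomial.constantCoeff : MvPolynomial (Fin n) k →+* k) ^ N ≤ I) →
      ∀ ν : ℕ, IsInitialDegree I ν → FirstTransformOrderLeOne I ν →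
        Scheme.HasResolution (affineBlowup I)

/-- Piece O2 sliced = **THE LOCATED RESIDUAL** (declared): punctual ideals whose first weak transform still has a
closed point of order ≥ 2.  NECESSARY (kernel) · UNDECIDED · residual-axis score 0 · LOCATED on Cell(4,4,p) at
«c vanishes at a vertex point of q» (all rank ≤ 2 q; isolated-vertex q with c(v) = 0), with the point-tower descent
and its stall locus in the module docstring · IDEA-NEEDED (curve order-2 loci in a fourfold) · INSTRUMENTABLE
(μ-profile, T-mu1-punct).  [CossartPiltant2019, Hironaka1964, Kollar2007] -/
def OrderTwoPunctualResolveAt (n : ℕ) : Prop :=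
  ∀ p : ℕ, p.Prime → ∀ (k : Type) [Field k] [CharP k p] (I : Ideal (MvPolynomial (Fin n) k)), I ≠ ⊥ →
    (∃ N : ℕ, RingHom.ker (MvPolynomial.constantCoeff : MvPolynomial (Fin n) k →+* k) ^ N ≤ I) →
      ∀ ν : ℕ, IsInitialDegree I ν → ¬ FirstTransformOrderLeOne I ν →
        Scheme.HasResolution (affineBlowup I)

/-- Rung SCR sliced: **punctual ideals with a smooth cone member have resolvable blow-ups** (in `n` variables).
NECESSARY (kernel) · ⊆ O1-class (paper) · WEAKER-BY-DIMENSION-DROP: THEOREM A = `ConeTransfer` reduces it to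
`MarkedPrincipalization (n-1)` with no seam; `n ≤ 4` KNOWN-MOD-PORT{X1@1-weak}; `n ≥ 5` ATTACKABLE ⟸ the port in
dimension `n-1` alone.  Why it might fail: only with the port (marked principalization on regular `(n-1)`-folds in
characteristic p, open from `n-1 = 4`).  [Cutkosky2009 5.1, CossartPiltant2019 4.4, Kollar2007 3.105] -/
def SmoothConePunctualResolveAt (n : ℕ) : Prop :=
  ∀ p : ℕ, p.Prime → ∀ (k : Type) [Field k] [CharP k p] (I : Ideal (MvPolynomial (Fin n) k)), I ≠ ⊥ →
    (∃ N : ℕ, RingHom.ker (MvPolynomial.constantCoeff : MvPolynomial (Fin n) k →+* k) ^ N ≤ I) →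
      HasSmoothConeMember I → Scheme.HasResolution (affineBlowup I)

/-- THE PORT, sliced by the dimension bound `d`: **marked principalization `(J, ∅, 1)` on regular schemes of
dimension ≤ d, separated and of finite type over a field of characteristic p** — for `d = 3` this is lens-5 g5's
`Exhaustion.MarkedThreefoldResolutionAt 1` VERBATIM (X1 at marking 1).  PORT · KNOWN in print for `d ≤ 3` at marking
1 over any field (CossartPiltant2019 Prop 4.4 + 4.3/CJS + peeling; weak form over k̄ = Cutkosky2009 Thm 5.1 (r = 1),
`d = 2` any field = Cutkosky2009 Lemma 5.2) · open from `d = 4` · not summit-implied as typed (sequence form with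
snc admissibility), declared.  [CossartPiltant2019, Cutkosky2009, CossartJannsenSaito2020,
BierstoneGrigorievMilmanWlodarczyk2011] -/
def MarkedPrincipalization (d : ℕ) : Prop :=
  ∀ p : ℕ, p.Prime → ∀ (k : Type) [Field k] [CharP k p] (S : Scheme.{0}) (g : S ⟶ Spec (.of k)),
    IsSeparated g → LocallyOfFiniteType g → QuasiCompact g → Scheme.IsRegular S →
    topologicalKrullDim S ≤ (d : WithBot ℕ∞) →
    ∀ J : S.IdealSheafData, (∀ y : S, idealOrder J y ≠ ⊤) →
      ∃ t : CentreSeq S, t.IsResolutionOf (⟨J, [], 1⟩ : MarkedIdeal S)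

/-! ## Kernels (sliced; 0 sorry) -/

/-- Every nonzero ideal of `k[x₁,…,xₙ]` has an initial degree. -/
theorem exists_isInitialDegree {k : Type} [Field k] {n : ℕ} (I : Ideal (MvPolynomial (Fin n) k))
    (hI : I ≠ ⊥) : ∃ ν : ℕ, IsInitialDegree I ν := by
  classical
  have hex : ∃ d : ℕ, ∃ f ∈ I, MvPolynomial.homogeneousComponent d f ≠ 0 := by
    obtain ⟨f, hfI, hf0⟩ := Submodule.exists_mem_ne_zero_of_ne_bot hI
    by_contra hcon
    push Not at hcon
    apply hf0
    rw [← MvPolynomial.sum_homogeneousComponent f]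
    exact Finset.sum_eq_zero fun d _ => hcon d f hfI
  refine ⟨Nat.find hex, ?_, Nat.find_spec hex⟩
  intro f hf d hd
  by_contra h
  exact Nat.find_min hex hd ⟨f, hf, h⟩

/-- The initial degree is unique. -/
theorem isInitialDegree_unique {k : Type} [Field k] {n : ℕ} {I : Ideal (MvPolynomial (Fin n) k)} {ν ν' : ℕ}
    (h : IsInitialDegree I ν) (h' : IsInitialDegree I ν') : ν = ν' := by
  obtain ⟨hlow, g, hg, hgν⟩ := h
  obtain ⟨hlow', g', hg', hgν'⟩ := h'
  by_contra hne
  rcases Nat.lt_or_gt_of_ne hne with hlt | hgt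
  · exact hgν (hlow' g hg ν hlt)
  · exact hgν' (hlow g' hg' ν' hgt)

/-- **EXACT BISECTION, sliced**: `APRAt n ⟺ O1At n ∧ O2At n` (excluded middle on the datum `μ₁(I) ≤ 1`). -/
theorem affinePunctualResolveAt_iff (n : ℕ) :
    AffinePunctualResolveAt n ↔ OrderOnePunctualResolveAt n ∧ OrderTwoPunctualResolveAt n := by
  constructor
  · intro h
    exact ⟨fun p hp k _ _ I hI hN _ _ _ => h p hp k I hI hN, fun p hp k _ _ I hI hN _ _ _ => h p hp k I hI hN⟩
  · rintro ⟨h1, h2⟩ p hp k _ _ I hI hN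
    obtain ⟨ν, hν⟩ := exists_isInitialDegree I hI
    by_cases hμ : FirstTransformOrderLeOne I ν
    · exact h1 p hp k I hI hN ν hν hμ
    · exact h2 p hp k I hI hN ν hν hμ

/-- The port is monotone in the dimension bound. -/
theorem markedPrincipalization_mono {d d' : ℕ} (hdd : d ≤ d') (h : MarkedPrincipalization d') :
    MarkedPrincipalization d := by
  intro p hp k _ _ S g hg1 hg2 hg3 hS hdim J hJ
  exact h p hp k S g hg1 hg2 hg3 hS (hdim.trans (by exact_mod_cast hdd)) J hJ

/-- LOCATION in the frontier dimension: given O1₄ (closed mod ports), APR₄ ⟺ the residual O2₄. -/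
theorem affinePunctualResolveAt_four_iff (h1 : OrderOnePunctualResolveAt 4) :
    AffinePunctualResolveAt 4 ↔ OrderTwoPunctualResolveAt 4 :=
  ⟨fun h => ((affinePunctualResolveAt_iff 4).mp h).2, fun h2 => (affinePunctualResolveAt_iff 4).mpr ⟨h1, h2⟩⟩

end Summit.ResolutionOfSingularities.ResolutionOfSingularities.Theorems.PunctualFirstTransform
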